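import Summits.MatrixMultiplication.OmegaCensus.DominoZ5LineTables
import HarnessLib

/-!
# Modular Farkas certificates for the THREE-SET line identity (a part `W` of any size; generic odd or even `q`)

ω-census `pub-omega`, family (b3), seat pub-omega-group gen 36.  Framing: lottery ticket; floor = certified bounds/negative
ranges.  VALUE: the `|W| ≥ 2` analogue of `DominoLineCertificate.no_line_identity_of_certificate` (which is the case
`W = {0}`): an order-free necessary condition for the three-set cube cells of the Dih-side `|A| ≡ 1 (mod 3)` classification;
NOT progress on ω.

Setting.  A cube symmetric form `(W, X, Y, x₀)` over `A` (`CubeSymmetricForm.cube_symmetric_form_of_law`) pushed along a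
surjection `φ : A ↠ ℤ_q` gives fibre counts `W, F, G : ZMod q → ℕ` of `W, X, Y` with the three-set line identity
(`ThreeSetCharacterIdentities.three_set_line_identity`, from `RadonProjection3.radon_identity₃`)
`Σ_u M(τ,u)·G(u) + [s = τ] = K` for every `τ`, where
`M(τ,u) = Σ_v W(v)·(F(τ−u+v) + F(v+u−τ) + F(τ+u−v))` (`lineMat3`) and `K = |ker φ|`.
* `lineMat3_row_sum`, `lineMat3_col_sum` — all row and column sums of `M` equal `3·(ΣW)·(ΣF)`.
* **`no_line_identity3_of_certificate`** — if `z : ZMod q → ℕ` and a modulus `N` satisfy `Σ_τ z(τ)·M(τ,u) ≡ 0 (mod N)` for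
  every `u` and `Σ z ≢ q·z(s) (mod N)`, then NO `G, K` satisfy the identity (summing the identity gives
  `qK = 3(ΣW)(ΣF)(ΣG) + 1`; pairing with `z` gives `z(s) ≡ K·Σz` and `3(ΣW)(ΣF)·Σz ≡ 0`, whence `q·z(s) ≡ Σz`).  The
  certificate mentions neither `G` nor `K`: ONE certificate for the image data `(W, F, s)` excludes every order `|A|` at once.
* `lineCert3At q W F certs s` — the `Bool` list form (every listed `(N, z)` annihilates `M` mod `N`; some listed one excludes
  `s`), and its soundness `lineCert3At_sound`.
The finite tables for `q = 5`, `|W| = 3`, `|X| = 6` and the plane enumeration live in `ThreeSetZ5LineTable6*.lean`,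
`ThreeSetZ5Z5Cover6*.lean`; the cell theorem in `ThreeSetZ5Z5Cells36.lean`.
-/

namespace Summit.MatrixMultiplication.OmegaCensus

open Finset

section Certificate

variable {q : ℕ} [NeZero q]

/-- The three-set line matrix `M(τ,u) = Σ_v W(v)·(F(τ−u+v) + F(v+u−τ) + F(τ+u−v))`. [folklore] -/
def lineMat3 (W F : ZMod q → ℕ) (τ u : ZMod q) : ℕ := ∑ v : ZMod q, W v * (F (τ - u + v) + F (v + u - τ) + F (τ + u - v))

/-- Row sums of the three-set line matrix: `Σ_u M(τ,u) = 3·(ΣW)·(ΣF)`. [folklore] -/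
theorem lineMat3_row_sum (W F : ZMod q → ℕ) (τ : ZMod q) :
    ∑ u : ZMod q, lineMat3 W F τ u = 3 * (∑ v : ZMod q, W v) * ∑ v : ZMod q, F v := by
  unfold lineMat3
  rw [sum_comm]
  have key : ∀ v : ZMod q, ∑ u : ZMod q, W v * (F (τ - u + v) + F (v + u - τ) + F (τ + u - v)) =
      W v * (3 * ∑ x : ZMod q, F x) := by
    intro v
    rw [← mul_sum, sum_add_distrib, sum_add_distrib,
      Fintype.sum_equiv (Equiv.subLeft (τ + v)) (fun u => F (τ - u + v)) F fun u => by
        rw [Equiv.subLeft_apply]; congr 1; abel,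
      Fintype.sum_equiv (Equiv.addRight (v - τ)) (fun u => F (v + u - τ)) F fun u => by
        rw [Equiv.coe_addRight]; congr 1; abel,
      Fintype.sum_equiv (Equiv.addRight (τ - v)) (fun u => F (τ + u - v)) F fun u => by
        rw [Equiv.coe_addRight]; congr 1; abel]
    ring
  rw [Fintype.sum_congr _ _ key, ← sum_mul]
  ring

/-- Column sums of the three-set line matrix: `Σ_τ M(τ,u) = 3·(ΣW)·(ΣF)`. [folklore] -/
theorem lineMat3_col_sum (W F : ZMod q → ℕ) (u : ZMod q) :
    ∑ τ : ZMod q, lineMat3 W F τ u = 3 * (∑ v : ZMod q, W v) * ∑ v : ZMod q, F v := by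
  unfold lineMat3
  rw [sum_comm]
  have key : ∀ v : ZMod q, ∑ τ : ZMod q, W v * (F (τ - u + v) + F (v + u - τ) + F (τ + u - v)) =
      W v * (3 * ∑ x : ZMod q, F x) := by
    intro v
    rw [← mul_sum, sum_add_distrib, sum_add_distrib,
      Fintype.sum_equiv (Equiv.addRight (v - u)) (fun τ => F (τ - u + v)) F fun τ => by
        rw [Equiv.coe_addRight]; congr 1; abel,
      Fintype.sum_equiv (Equiv.subLeft (v + u)) (fun τ => F (v + u - τ)) F fun τ => by
        rw [Equiv.subLeft_apply],
      Fintype.sum_equiv (Equiv.addRight (u - v)) (fun τ => F (τ + u - v)) F fun τ => by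
        rw [Equiv.coe_addRight]; congr 1; abel]
    ring
  rw [Fintype.sum_congr _ _ key, ← sum_mul]
  ring

/-- **No three-set line identity under a modular Farkas certificate.**  If `Σ_τ z(τ)·M(τ,u) ≡ 0 (mod N)` for all `u` and
`Σ_τ z(τ) ≢ q·z(s) (mod N)`, then no `G : ZMod q → ℕ` and constant `K` satisfy `Σ_u M(τ,u)·G(u) + [s = τ] = K` for all `τ`.
[folklore] -/
theorem no_line_identity3_of_certificate (W F G : ZMod q → ℕ) (s : ZMod q) (K : ℕ)
    (hid : ∀ τ : ZMod q, (∑ u : ZMod q, lineMat3 W F τ u * G u) + (if s = τ then 1 else 0) = K)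
    (N : ℕ) (z : ZMod q → ℕ)
    (hz : ∀ u : ZMod q, ((∑ τ : ZMod q, z τ * lineMat3 W F τ u : ℕ) : ZMod N) = 0)
    (hs : ((∑ τ : ZMod q, z τ : ℕ) : ZMod N) ≠ ((q * z s : ℕ) : ZMod N)) : False := by
  set c := 3 * (∑ v : ZMod q, W v) * ∑ v : ZMod q, F v with hc
  set e := ∑ v : ZMod q, G v with he
  -- (1) summing the identity over `τ`: `c·e + 1 = qK`
  have htot : c * e + 1 = q * K := by
    have h1 := congrArg (fun f : ZMod q → ℕ => ∑ τ, f τ) (funext hid)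
    simp only [sum_add_distrib, sum_const, card_univ, ZMod.card, smul_eq_mul] at h1
    rw [sum_ite_eq, if_pos (mem_univ _), sum_comm] at h1
    have h2 : ∑ y : ZMod q, ∑ x : ZMod q, lineMat3 W F x y * G y = c * e := by
      rw [he, mul_sum]
      refine sum_congr rfl fun y _ => ?_
      rw [← sum_mul, lineMat3_col_sum, hc]
    omega
  -- (2) pairing with `z`: `z s ≡ K Σz (mod N)`
  have hpair : ((z s : ℕ) : ZMod N) = ((K * ∑ τ : ZMod q, z τ : ℕ) : ZMod N) := by
    have h1 : ∑ τ : ZMod q, z τ * ((∑ u : ZMod q, lineMat3 W F τ u * G u) + (if s = τ then 1 else 0)) =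
        ∑ τ : ZMod q, z τ * K := sum_congr rfl fun τ _ => by rw [hid τ]
    simp only [mul_add, sum_add_distrib, mul_ite, mul_one, mul_zero, sum_ite_eq, mem_univ, if_true] at h1
    have h2 : ((∑ τ : ZMod q, z τ * ∑ u : ZMod q, lineMat3 W F τ u * G u : ℕ) : ZMod N) = 0 := by
      have : ∑ τ : ZMod q, z τ * ∑ u : ZMod q, lineMat3 W F τ u * G u =
          ∑ u : ZMod q, G u * ∑ τ : ZMod q, z τ * lineMat3 W F τ u := by
        simp_rw [mul_sum]
        rw [sum_comm]
        exact sum_congr rfl fun u _ => sum_congr rfl fun τ _ => by ring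
      rw [this, Nat.cast_sum]
      refine sum_eq_zero fun u _ => ?_
      rw [Nat.cast_mul, hz u, mul_zero]
    have h1c := congrArg (Nat.cast : ℕ → ZMod N) h1
    rw [Nat.cast_add, h2, zero_add] at h1c
    rw [h1c, mul_sum]
    exact congrArg _ (sum_congr rfl fun τ _ => mul_comm _ _)
  -- (3) `c Σz ≡ 0 (mod N)`
  have h3d : ((c * ∑ τ : ZMod q, z τ : ℕ) : ZMod N) = 0 := by
    have h1 : ((∑ u : ZMod q, ∑ τ : ZMod q, z τ * lineMat3 W F τ u : ℕ) : ZMod N) = 0 := by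
      push_cast
      refine sum_eq_zero fun u _ => ?_
      have := hz u
      push_cast at this
      exact this
    have h2 : ∑ u : ZMod q, ∑ τ : ZMod q, z τ * lineMat3 W F τ u = c * ∑ τ : ZMod q, z τ := by
      rw [sum_comm, mul_sum]
      refine sum_congr rfl fun τ _ => ?_
      rw [← mul_sum, lineMat3_row_sum, hc]; ring
    rw [h2] at h1
    exact h1
  -- (4) `q z s ≡ qK Σz = (ce+1) Σz ≡ Σz`
  apply hs
  have : ((q * z s : ℕ) : ZMod N) = (((c * e + 1) * ∑ τ : ZMod q, z τ : ℕ) : ZMod N) := by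
    rw [htot]; push_cast; rw [hpair]; push_cast; ring
  rw [this]; push_cast
  have h3 : ((c : ZMod N) * ∑ τ : ZMod q, (z τ : ZMod N)) = 0 := by exact_mod_cast h3d
  linear_combination -(e : ZMod N) * h3

/-- **Three-set modular Farkas certificate check at a hole position `s`** (list form, arithmetic in `ℕ`, a `Bool`):
every `(N, z) ∈ certs` has `Σ_τ z(τ)·M(τ,u) ≡ 0 (mod N)` for all `u`, and SOME `(N, z) ∈ certs` has
`Σ z ≢ q·z(s) (mod N)`. [folklore] -/
def lineCert3At (q : ℕ) [NeZero q] (W F : ZMod q → ℕ) (certs : List (ℕ × List ℕ)) (s : ZMod q) : Bool :=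
  decide ((∀ c ∈ certs, ∀ u : ZMod q, (∑ τ : ZMod q, c.2.getD τ.val 0 * lineMat3 W F τ u) % c.1 = 0) ∧
    ∃ c ∈ certs, (∑ τ : ZMod q, c.2.getD τ.val 0) % c.1 ≠ (q * c.2.getD s.val 0) % c.1)

/-- **Soundness of the list certificate**: if `lineCert3At q W F certs s` holds, no `G, K` satisfy the three-set line
identity with hole position `s`. [folklore] -/
theorem lineCert3At_sound {W F : ZMod q → ℕ} {certs : List (ℕ × List ℕ)} {s : ZMod q}
    (h : lineCert3At q W F certs s = true) (G : ZMod q → ℕ) (K : ℕ)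
    (hid : ∀ τ : ZMod q, (∑ u : ZMod q, lineMat3 W F τ u * G u) + (if s = τ then 1 else 0) = K) : False := by
  have h' := of_decide_eq_true h
  obtain ⟨c, hc, hs⟩ := h'.2
  refine no_line_identity3_of_certificate W F G s K hid c.1 (vecFn c.2) (fun u => ?_) ?_
  · have h0 := h'.1 c hc u
    have e := (ZMod.natCast_eq_natCast_iff' (∑ τ : ZMod q, c.2.getD τ.val 0 * lineMat3 W F τ u) 0 c.1).2
      (h0.trans (Nat.zero_mod _).symm)
    rw [Nat.cast_zero] at e
    exact e
  · exact fun e => hs ((ZMod.natCast_eq_natCast_iff' _ _ c.1).1 e)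

/-- The three-set line identity in the shape produced by `three_set_line_identity` (double sum, `W v * (…) * G u`) is the
`lineMat3` identity. [folklore] -/
theorem lineMat3_identity_of_double_sum {W F G : ZMod q → ℕ} {s : ZMod q} {K : ℕ}
    (hid : ∀ τ : ZMod q, (∑ u : ZMod q, ∑ v : ZMod q, W v * (F (τ - u + v) + F (v + u - τ) + F (τ + u - v)) * G u) +
      (if s = τ then 1 else 0) = K) (τ : ZMod q) :
    (∑ u : ZMod q, lineMat3 W F τ u * G u) + (if s = τ then 1 else 0) = K := by
  rw [← hid τ]
  congr 1
  exact sum_congr rfl fun u _ => by rw [lineMat3, sum_mul]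

end Certificate

end Summit.MatrixMultiplication.OmegaCensus
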